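import Summits.AnomalousDissipation.AnomalousDissipation.Theorems.SawtoothPulseCascadeK1LocalisedCascadeFlatSlope

/-!
# K1loc, line `Spectral` — S-D (first good piece): THE CASCADE PROFILE IS AFFINE ON THE FLATS UP TO THE SLOPE DEFECT

Helper file of the prover lane on the crux `K1LocalisedCascade` (stmt-AnomalousDissipation-19491), route
`SawtoothPulseCascade`, registered line `Cruxes.K1LocalisedCascade.Spectral` (one open stub `stub_highModeConcentration`).
Channel (S) of the analytic first good piece (memo v8 §1): on an `M`-flat of the rounded sawtooth `U_j` (phase `2πN_j y` at
distance `≥ Mδ_j` from every corner, `M ≥ 1`) the slope is `±1` up to `η_M = 2e^{−M²/2}` (`…K1Flat.abs_deriv_U_sub_one_le` /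
`abs_deriv_U_add_one_le`), hence by the mean value theorem, for `y, y'` in one flat component `[a, b]`:

  `|U_j(y) − U_j(y') ∓ (y − y')| ≤ 2e^{−M²/2} · |y − y'|`      (`abs_U_sub_U_sub_le`, `abs_U_sub_U_add_le`),

and the shear displacement `γU_j` is affine on the component up to `γ · 2e^{−M²/2} · (b − a)` (`abs_shear_sub_affine_le`,
`abs_shear_add_affine_le`): on a flat of length `≤ 1/(2N_j)` the pulse map `x ↦ x ∓ γU_j(x_j)eᵢ` differs from an affine shear by at
most `ε_j = γη_M/(2N_j)` — the per-stage slope-defect cost of memo v8 §1 (S).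

WHAT THIS IS NOT: no statement about the iterate or the cells; profile calculus only.
[cite: ElgindiLissMattingly2025, §1 (slope ±1 branches of H_α, V_α; here mollified)] [problem: turb]
-/

-- `Summit.<Summit>.<Problem>`: single-conjunct summit, the duplicate namespace segment is deliberate.
set_option linter.dupNamespace false

noncomputable section

namespace Summit.AnomalousDissipation.AnomalousDissipation.Theorems.SawtoothPulseCascade.K1Start

open MeasureTheory Set Filter Topology Function
open Literature.Analysis Literature.Analysis.FunctionSpaces
open Literature.Analysis.FluidPDE.SawtoothCascade Literature.Analysis.FluidPDE.SawtoothCascade.CascadeParams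

variable (P : CascadeParams)

/-- On an interval `[a, b]` whose phases are `Mδ_j`-inside the ascending branch `k` the slope defect is uniform:
`|U_j′(z) − 1| ≤ 2e^{−M²/2}` for all `z ∈ [a, b]`. [cite: ElgindiLissMattingly2025, §1 (slope ±1 branches)] -/
theorem abs_deriv_U_sub_one_le_of_mem (hδ₀ : 0 < P.δ₀) (hd : 0 < P.d) (hN₀ : 1 ≤ P.N₀) (hρ : 1 ≤ P.ρN) {j : ℕ} {M a b : ℝ}
    (hM : 1 ≤ M) (k : ℤ) (ha : -(Real.pi / 2) + 2 * Real.pi * k < 2 * Real.pi * P.N j * a - M * P.δ j)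
    (hb : 2 * Real.pi * P.N j * b + M * P.δ j < Real.pi / 2 + 2 * Real.pi * k) {z : ℝ} (hz : z ∈ Icc a b) :
    |deriv (P.U j) z - 1| ≤ 2 * Real.exp (-(M ^ 2 / 2)) := by
  have hNpos : (0 : ℝ) < P.N j := by exact_mod_cast P.N_pos hN₀ hρ j
  refine K1Flat.abs_deriv_U_sub_one_le P (P.δ_pos hδ₀ hd j) (P.N_pos hN₀ hρ j).ne' hM k ?_ ?_
  · have : 2 * Real.pi * P.N j * a ≤ 2 * Real.pi * P.N j * z :=
      mul_le_mul_of_nonneg_left hz.1 (by positivity)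
    linarith
  · have : 2 * Real.pi * P.N j * z ≤ 2 * Real.pi * P.N j * b :=
      mul_le_mul_of_nonneg_left hz.2 (by positivity)
    linarith

/-- On an interval `[a, b]` whose phases are `Mδ_j`-inside the descending branch `k`:
`|U_j′(z) + 1| ≤ 2e^{−M²/2}` for all `z ∈ [a, b]`. [cite: ElgindiLissMattingly2025, §1 (slope ±1 branches)] -/
theorem abs_deriv_U_add_one_le_of_mem (hδ₀ : 0 < P.δ₀) (hd : 0 < P.d) (hN₀ : 1 ≤ P.N₀) (hρ : 1 ≤ P.ρN) {j : ℕ} {M a b : ℝ}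
    (hM : 1 ≤ M) (k : ℤ) (ha : Real.pi / 2 + 2 * Real.pi * k < 2 * Real.pi * P.N j * a - M * P.δ j)
    (hb : 2 * Real.pi * P.N j * b + M * P.δ j < 3 * Real.pi / 2 + 2 * Real.pi * k) {z : ℝ} (hz : z ∈ Icc a b) :
    |deriv (P.U j) z + 1| ≤ 2 * Real.exp (-(M ^ 2 / 2)) := by
  have hNpos : (0 : ℝ) < P.N j := by exact_mod_cast P.N_pos hN₀ hρ j
  refine K1Flat.abs_deriv_U_add_one_le P (P.δ_pos hδ₀ hd j) (P.N_pos hN₀ hρ j).ne' hM k ?_ ?_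
  · have : 2 * Real.pi * P.N j * a ≤ 2 * Real.pi * P.N j * z :=
      mul_le_mul_of_nonneg_left hz.1 (by positivity)
    linarith
  · have : 2 * Real.pi * P.N j * z ≤ 2 * Real.pi * P.N j * b :=
      mul_le_mul_of_nonneg_left hz.2 (by positivity)
    linarith

/-- **Affine on ascending flats.**  For `y, y'` in an interval `[a, b]` `Mδ_j`-inside the ascending branch `k` of `U_j`:
`|U_j(y) − U_j(y') − (y − y')| ≤ 2e^{−M²/2} |y − y'|` (mean value theorem with `|U_j′ − 1| ≤ 2e^{−M²/2}`).
[cite: ElgindiLissMattingly2025, §1 (slope ±1 branches)] -/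
theorem abs_U_sub_U_sub_le (hδ₀ : 0 < P.δ₀) (hd : 0 < P.d) (hN₀ : 1 ≤ P.N₀) (hρ : 1 ≤ P.ρN) {j : ℕ} {M a b : ℝ}
    (hM : 1 ≤ M) (k : ℤ) (ha : -(Real.pi / 2) + 2 * Real.pi * k < 2 * Real.pi * P.N j * a - M * P.δ j)
    (hb : 2 * Real.pi * P.N j * b + M * P.δ j < Real.pi / 2 + 2 * Real.pi * k) {y y' : ℝ} (hy : y ∈ Icc a b)
    (hy' : y' ∈ Icc a b) :
    |P.U j y - P.U j y' - (y - y')| ≤ 2 * Real.exp (-(M ^ 2 / 2)) * |y - y'| := by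
  have hdiff : Differentiable ℝ (P.U j) := (P.contDiff_U (P.δ_pos hδ₀ hd j) (n := 1)).differentiable one_ne_zero
  have hf : ∀ z ∈ Icc a b, DifferentiableAt ℝ (fun z => P.U j z - z) z := fun z _ =>
    (hdiff z).sub differentiableAt_id
  have hbound : ∀ z ∈ Icc a b, ‖deriv (fun z => P.U j z - z) z‖ ≤ 2 * Real.exp (-(M ^ 2 / 2)) := fun z hz => by
    rw [show deriv (fun z => P.U j z - z) z = deriv (P.U j) z - 1 from ((hdiff z).hasDerivAt.sub (hasDerivAt_id z)).deriv,
      Real.norm_eq_abs]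
    exact abs_deriv_U_sub_one_le_of_mem P hδ₀ hd hN₀ hρ hM k ha hb hz
  have h := (convex_Icc a b).norm_image_sub_le_of_norm_deriv_le hf hbound hy' hy
  rw [Real.norm_eq_abs, Real.norm_eq_abs] at h
  rw [show P.U j y - P.U j y' - (y - y') = (P.U j y - y) - (P.U j y' - y') by ring]
  exact h

/-- **Affine on descending flats.**  For `y, y'` in an interval `[a, b]` `Mδ_j`-inside the descending branch `k` of `U_j`:
`|U_j(y) − U_j(y') + (y − y')| ≤ 2e^{−M²/2} |y − y'|`. [cite: ElgindiLissMattingly2025, §1 (slope ±1 branches)] -/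
theorem abs_U_sub_U_add_le (hδ₀ : 0 < P.δ₀) (hd : 0 < P.d) (hN₀ : 1 ≤ P.N₀) (hρ : 1 ≤ P.ρN) {j : ℕ} {M a b : ℝ}
    (hM : 1 ≤ M) (k : ℤ) (ha : Real.pi / 2 + 2 * Real.pi * k < 2 * Real.pi * P.N j * a - M * P.δ j)
    (hb : 2 * Real.pi * P.N j * b + M * P.δ j < 3 * Real.pi / 2 + 2 * Real.pi * k) {y y' : ℝ} (hy : y ∈ Icc a b)
    (hy' : y' ∈ Icc a b) :
    |P.U j y - P.U j y' + (y - y')| ≤ 2 * Real.exp (-(M ^ 2 / 2)) * |y - y'| := by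
  have hdiff : Differentiable ℝ (P.U j) := (P.contDiff_U (P.δ_pos hδ₀ hd j) (n := 1)).differentiable one_ne_zero
  have hf : ∀ z ∈ Icc a b, DifferentiableAt ℝ (fun z => P.U j z + z) z := fun z _ =>
    (hdiff z).add differentiableAt_id
  have hbound : ∀ z ∈ Icc a b, ‖deriv (fun z => P.U j z + z) z‖ ≤ 2 * Real.exp (-(M ^ 2 / 2)) := fun z hz => by
    rw [show deriv (fun z => P.U j z + z) z = deriv (P.U j) z + 1 from ((hdiff z).hasDerivAt.add (hasDerivAt_id z)).deriv,
      Real.norm_eq_abs]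
    exact abs_deriv_U_add_one_le_of_mem P hδ₀ hd hN₀ hρ hM k ha hb hz
  have h := (convex_Icc a b).norm_image_sub_le_of_norm_deriv_le hf hbound hy' hy
  rw [Real.norm_eq_abs, Real.norm_eq_abs] at h
  rw [show P.U j y - P.U j y' + (y - y') = (P.U j y + y) - (P.U j y' + y') by ring]
  exact h

/-- **The shear displacement is affine on an ascending flat component up to `γη_M(b − a)`.**  With the reference point `a`:
`|γU_j(y) − (γU_j(a) + γ(y − a))| ≤ γ · 2e^{−M²/2} · (b − a)` for `y ∈ [a, b]` (`γ ≥ 0`). [cite: ElgindiLissMattingly2025, §1] -/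
theorem abs_shear_sub_affine_le (hγ : 0 ≤ P.γ) (hδ₀ : 0 < P.δ₀) (hd : 0 < P.d) (hN₀ : 1 ≤ P.N₀) (hρ : 1 ≤ P.ρN) {j : ℕ}
    {M a b : ℝ} (hM : 1 ≤ M) (k : ℤ) (ha : -(Real.pi / 2) + 2 * Real.pi * k < 2 * Real.pi * P.N j * a - M * P.δ j)
    (hb : 2 * Real.pi * P.N j * b + M * P.δ j < Real.pi / 2 + 2 * Real.pi * k) {y : ℝ} (hy : y ∈ Icc a b) :
    |P.γ * P.U j y - (P.γ * P.U j a + P.γ * (y - a))| ≤ P.γ * (2 * Real.exp (-(M ^ 2 / 2))) * (b - a) := by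
  have hab : a ≤ b := hy.1.trans hy.2
  have h := abs_U_sub_U_sub_le P hδ₀ hd hN₀ hρ hM k ha hb hy (left_mem_Icc.mpr hab)
  rw [show P.γ * P.U j y - (P.γ * P.U j a + P.γ * (y - a)) = P.γ * (P.U j y - P.U j a - (y - a)) by ring, abs_mul,
    abs_of_nonneg hγ, mul_assoc]
  refine mul_le_mul_of_nonneg_left (h.trans ?_) hγ
  refine mul_le_mul_of_nonneg_left ?_ (by positivity)
  rw [abs_of_nonneg (by linarith [hy.1])]
  linarith [hy.2]

/-- **The shear displacement is affine on a descending flat component up to `γη_M(b − a)`.**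
`|γU_j(y) − (γU_j(a) − γ(y − a))| ≤ γ · 2e^{−M²/2} · (b − a)` for `y ∈ [a, b]` (`γ ≥ 0`). [cite: ElgindiLissMattingly2025, §1] -/
theorem abs_shear_add_affine_le (hγ : 0 ≤ P.γ) (hδ₀ : 0 < P.δ₀) (hd : 0 < P.d) (hN₀ : 1 ≤ P.N₀) (hρ : 1 ≤ P.ρN) {j : ℕ}
    {M a b : ℝ} (hM : 1 ≤ M) (k : ℤ) (ha : Real.pi / 2 + 2 * Real.pi * k < 2 * Real.pi * P.N j * a - M * P.δ j)
    (hb : 2 * Real.pi * P.N j * b + M * P.δ j < 3 * Real.pi / 2 + 2 * Real.pi * k) {y : ℝ} (hy : y ∈ Icc a b) :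
    |P.γ * P.U j y - (P.γ * P.U j a - P.γ * (y - a))| ≤ P.γ * (2 * Real.exp (-(M ^ 2 / 2))) * (b - a) := by
  have hab : a ≤ b := hy.1.trans hy.2
  have h := abs_U_sub_U_add_le P hδ₀ hd hN₀ hρ hM k ha hb hy (left_mem_Icc.mpr hab)
  rw [show P.γ * P.U j y - (P.γ * P.U j a - P.γ * (y - a)) = P.γ * (P.U j y - P.U j a + (y - a)) by ring, abs_mul,
    abs_of_nonneg hγ, mul_assoc]
  refine mul_le_mul_of_nonneg_left (h.trans ?_) hγ
  refine mul_le_mul_of_nonneg_left ?_ (by positivity)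
  rw [abs_of_nonneg (by linarith [hy.1])]
  linarith [hy.2]

end Summit.AnomalousDissipation.AnomalousDissipation.Theorems.SawtoothPulseCascade.K1Start
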